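import Summits.Ventures.PercRepro.RankLevelSetLevelFiveCqFifteenOne
import Summits.Ventures.PercRepro.S2FourteenSeven

/-!
# PercRepro — S2: THEOREM C₅ AT `15` MODULO THE SPREAD CASE OF `(14, 7)` (p7, gen 14; sub-claim S2)

`c025_five_large_sharp15_of_one_cell` with the cell `(14, 7)` discharged modulo its spread case (S2FourteenSeven):
**`ThmN.c025_five_large_sharp15_of_spread (hspread) (M) (p) (hp : 15 ≤ p) : RLS M p 5`**. The window of record stays «8 ≤ p ≤ 15»;
nothing about `p ≤ 14` is claimed. Axioms: standard.
-/

open scoped Matroid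

namespace PercRepro

namespace ThmN

open Set

variable {α : Type}

/-- **THEOREM C₅ AT `15` MODULO THE SPREAD CASE OF `(14, 7)`.** -/
theorem c025_five_large_sharp15_of_spread
    (hspread : ∀ (M : Matroid α) [M.Finite], M.eRank = ((14 : ℕ) : ℕ∞) → M.E.ncard = 14 + 7 →
      (∀ e ∈ M.E, ∃ A ⊆ M.E \ {e}, e ∉ M.closure A ∧ e ∉ M.closure ((M.E \ {e}) \ A)) → (∀ e, ¬ M.IsColoop e) →
      ¬ (∃ W ⊆ M.E, W.ncard ≤ 11 ∧ W.encard = M.eRk W + 6) → ¬ (∃ W ⊆ M.E, W.ncard ≤ 10 ∧ W.encard = M.eRk W + 5) →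
      ¬ (∃ W ⊆ M.E, W.ncard ≤ 9 ∧ W.encard = M.eRk W + 4) → RLS M 14 5)
    (M : Matroid α) [M.Finite] (p : ℕ) (hp : 15 ≤ p) : RLS M p 5 :=
  c025_five_large_sharp15_of_one_cell (fun M _ hR hn hfree => c025_core_five_fourteen_seven_of_spread hspread M hR hn hfree) M p hp

end ThmN

end PercRepro
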